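import Summits.AnomalousDissipation.AnomalousDissipation.Theorems.MarginalStabilityChainStrainedLayerLawStubVorticityUniformBoundsF
import Summits.AnomalousDissipation.AnomalousDissipation.Theorems.MarginalStabilityChainStrainedLayerLawStubVorticityUniformBoundsG
import Summits.AnomalousDissipation.AnomalousDissipation.Theorems.MarginalStabilityChainStrainedLayerLawStubVorticityUniformBoundsP
import Mathlib.Analysis.Calculus.ParametricIntegral

/-!
# Stub `stub_vorticityUniformBounds` (crux stmt-AnomalousDissipation-3007, line `strain-work-sum-rule`) — tools S:
# the time derivative of the weighted regularised `L¹` norm; the size of the moment error terms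

Support file (`--supports stmt-AnomalousDissipation-3007`; registered sub-goal `stub_vorticityUniformBounds_momentErr`).
* `kato_hasDerivAt_weightedL1`: differentiation under the integral sign for `∫∫ j_ε(ω(t))θ` with a bounded `C¹` weight
  `θ` of compact `y`-support;
* `stub_vorticityUniformBounds_momentErr`: in the shear-tails class, with the cutoff `ψ_R` (`R ≥ 1`), the six error terms
  of the moment balance (tools R) are `≤ a/R + ε·b(R)` with explicit `a`, `b(R)` (`e^{−x} ≤ 1/x`, `e^{−x} ≤ 4/x²`).
All `[folklore]`.
-/

-- `Summit.<Summit>.<Problem>` is the tree's mandated summit-side namespace (CONVENTIONS §2); for this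
-- single-conjunct summit the two coincide, so the duplicate is deliberate.
set_option linter.dupNamespace false

noncomputable section

open scoped Topology ENNReal
open Filter Set Function MeasureTheory

namespace Summit.AnomalousDissipation.AnomalousDissipation.Theorems.StrainedLayerLaw.StrainWorkSumRule

open Literature.Analysis.FluidPDE Literature.Analysis.FluidPDE.StretchedLayer
open Summit.AnomalousDissipation.AnomalousDissipation.Theorems.MarginalStabilityChainStretchedVortexRows

/-! ## The time derivative of the weighted, regularised `L¹` norm -/

section WeightedTime

/-- **Differentiation under the integral sign, bounded weight.** As `stub_vorticityUniformBounds_timeDerivative`,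
for a `C¹` weight `ψ` with `|ψ| ≤ M_ψ` vanishing for `|y| ≥ R′`. [folklore] -/
theorem kato_hasDerivAt_weightedL1 {u v : ℝ → ℝ → ℝ → ℝ}
    (hu : ContDiffOn ℝ 2 (fun q : ℝ × ℝ × ℝ => u q.1 q.2.1 q.2.2) (Ioi 0 ×ˢ univ))
    (hv : ContDiffOn ℝ 2 (fun q : ℝ × ℝ × ℝ => v q.1 q.2.1 q.2.2) (Ioi 0 ×ˢ univ)) {ε : ℝ} (hε : 0 < ε)
    {ψ : ℝ → ℝ} (hψ : ContDiff ℝ 1 ψ) {Mψ : ℝ} (hMψ : 0 ≤ Mψ) (hψ1 : ∀ y, |ψ y| ≤ Mψ) {R' : ℝ}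
    (hψ0 : ∀ y, R' ≤ |y| → ψ y = 0)
    (L : ℝ) {lo hi t : ℝ} (hlo : 0 < lo) (ht : t ∈ Ioo lo hi) :
    HasDerivAt (fun s => ∫ q in Ioc 0 L ×ˢ univ, Real.sqrt (vorticity (u s) (v s) q.1 q.2 ^ 2 + ε ^ 2) * ψ q.2)
      (∫ q in Ioc 0 L ×ˢ univ, vorticity (u t) (v t) q.1 q.2 /
          Real.sqrt (vorticity (u t) (v t) q.1 q.2 ^ 2 + ε ^ 2) * ψ q.2 *
        (dX (fun x y => deriv (fun s => v s x y) t) q.1 q.2 - dY (fun x y => deriv (fun s => u s x y) t) q.1 q.2))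
      t := by
  obtain ⟨kato_sq_add_sq_pos, kato_sqrt_pos, kato_le_sqrt, kato_abs_le_sqrt, kato_sqrt_le, kato_abs_jprime_le_one,
    kato_jsecond_nonneg, kato_G_nonpos, kato_mul_jprime_sub_G, kato_hasDerivAt_j, kato_hasDerivAt_jprime,
    kato_hasDerivAt_G⟩ := kato_modulus_props
  have ht0 : 0 < t := hlo.trans ht.1
  have hpos : ∀ {s : ℝ}, s ∈ Ioo lo hi → 0 < s := fun hs => hlo.trans hs.1
  have hSm : MeasurableSet (Ioc (0:ℝ) L ×ˢ (univ : Set ℝ)) := measurableSet_Ioc.prod MeasurableSet.univ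
  -- the time derivative of the vorticity as a space–time field, and a bound for it near `t`
  set Ψ : ℝ × ℝ × ℝ → ℝ := fun q => dX (fun x y => deriv (fun s => v s x y) q.1) q.2.1 q.2.2 -
    dY (fun x y => deriv (fun s => u s x y) q.1) q.2.1 q.2.2 with hΨ
  have hΨc : ContinuousOn Ψ (Ioi 0 ×ˢ univ) := kato_continuousOn_vorticity_time hu hv
  have hK : IsCompact (Icc lo hi ×ˢ (Icc (0:ℝ) L ×ˢ Icc (-R') R')) :=
    isCompact_Icc.prod (isCompact_Icc.prod isCompact_Icc)
  have hKO : Icc lo hi ×ˢ (Icc (0:ℝ) L ×ˢ Icc (-R') R') ⊆ Ioi (0:ℝ) ×ˢ (univ : Set (ℝ × ℝ)) :=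
    fun q hq => ⟨hlo.trans_le hq.1.1, mem_univ _⟩
  obtain ⟨M, hM⟩ := hK.exists_bound_of_continuousOn (hΨc.mono hKO)
  have hM'0 : 0 ≤ max M 0 := le_max_right _ _
  -- continuity
  have cω : ∀ {s : ℝ}, 0 < s → Continuous fun q : ℝ × ℝ => vorticity (u s) (v s) q.1 q.2 := fun hs =>
    (contDiff_one_vorticity (contDiff_slice hu (mem_Ioi.2 hs)) (contDiff_slice hv (mem_Ioi.2 hs))).continuous
  have cψ : Continuous ψ := hψ.continuous
  have csq : Continuous fun s : ℝ => Real.sqrt (s ^ 2 + ε ^ 2) := Real.continuous_sqrt.comp (by fun_prop)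
  have cjp : Continuous fun s : ℝ => s / Real.sqrt (s ^ 2 + ε ^ 2) :=
    continuous_id.div csq fun s => (kato_sqrt_pos hε s).ne'
  have cΨt : Continuous fun q : ℝ × ℝ => Ψ (t, q) :=
    hΨc.comp_continuous (continuous_const.prodMk continuous_id) fun q => ⟨ht0, mem_univ _⟩
  have hw1 : ∀ y : ℝ, |y| < R' → 1 ≤ Real.exp R' * Real.exp (-1 * |y|) := fun y hy => by
    rw [← Real.exp_add]; exact Real.one_le_exp (by linarith)
  have key := hasDerivAt_integral_of_dominated_loc_of_deriv_le (μ := volume.restrict (Ioc 0 L ×ˢ univ))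
    (F := fun s q => Real.sqrt (vorticity (u s) (v s) q.1 q.2 ^ 2 + ε ^ 2) * ψ q.2)
    (F' := fun s q => vorticity (u s) (v s) q.1 q.2 / Real.sqrt (vorticity (u s) (v s) q.1 q.2 ^ 2 + ε ^ 2) *
      ψ q.2 * Ψ (s, q))
    (bound := fun q => Mψ * max M 0 * Real.exp R' * Real.exp (-1 * |q.2|)) (Ioo_mem_nhds ht.1 ht.2) ?_ ?_ ?_ ?_ ?_ ?_
  · exact key.2
  · filter_upwards [Ioo_mem_nhds ht.1 ht.2] with s hs
    exact ((csq.comp (cω (hpos hs))).mul (cψ.comp continuous_snd)).aestronglyMeasurable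
  · exact kato_integrableOn_strip_of_eq_zero (R := R') ((csq.comp (cω ht0)).mul (cψ.comp continuous_snd))
      fun x _ y hy => by simp only [hψ0 y hy, mul_zero]
  · exact (((cjp.comp (cω ht0)).mul (cψ.comp continuous_snd)).mul cΨt).aestronglyMeasurable
  · refine ae_restrict_of_forall_mem hSm ?_
    rintro ⟨x, y⟩ ⟨hx, -⟩ s hs
    rw [Real.norm_eq_abs]
    by_cases hy : R' ≤ |y|
    · simp only [hψ0 y hy, mul_zero, zero_mul, abs_zero]; positivity
    · push Not at hy
      have hq : ((s, x, y) : ℝ × ℝ × ℝ) ∈ Icc lo hi ×ˢ (Icc (0:ℝ) L ×ˢ Icc (-R') R') :=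
        ⟨⟨hs.1.le, hs.2.le⟩, ⟨hx.1.le, hx.2⟩, abs_le.1 hy.le⟩
      have h1 : |Ψ (s, x, y)| ≤ max M 0 := (Real.norm_eq_abs _ ▸ hM _ hq).trans (le_max_left _ _)
      have h2 := kato_abs_jprime_le_one hε (vorticity (u s) (v s) x y)
      have h3 := hψ1 y
      rw [abs_mul, abs_mul]
      calc |vorticity (u s) (v s) x y / Real.sqrt (vorticity (u s) (v s) x y ^ 2 + ε ^ 2)| * |ψ y| *
            |Ψ (s, x, y)| ≤ 1 * Mψ * max M 0 :=
            mul_le_mul (mul_le_mul h2 h3 (abs_nonneg _) zero_le_one) h1 (abs_nonneg _) (by positivity)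
        _ = Mψ * max M 0 * 1 := by ring
        _ ≤ Mψ * max M 0 * (Real.exp R' * Real.exp (-1 * |y|)) := mul_le_mul_of_nonneg_left (hw1 y hy) (by positivity)
        _ = Mψ * max M 0 * Real.exp R' * Real.exp (-1 * |y|) := by ring
  · show IntegrableOn (fun q : ℝ × ℝ => Mψ * max M 0 * Real.exp R' * Real.exp (-1 * |q.2|)) (Ioc 0 L ×ˢ univ)
    refine integrableOn_strip_of_abs_le_exp (C := Mψ * max M 0 * Real.exp R') (k := 1) (by fun_prop) (by positivity)
      one_pos fun x _ y => ?_
    rw [abs_of_nonneg (by positivity)]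
  · refine ae_restrict_of_forall_mem hSm ?_
    rintro ⟨x, y⟩ - s hs
    have hω := stub_vorticityUniformBounds_vorticityTime hu hv (hpos hs) x y
    have hj := (HasDerivAt.comp (h₂ := fun r => Real.sqrt (r ^ 2 + ε ^ 2)) (h := fun s => vorticity (u s) (v s) x y)
      s (kato_hasDerivAt_j hε _) hω).mul_const (ψ y)
    refine hj.congr_deriv ?_
    simp only [hΨ]
    ring

end WeightedTime

/-! ## Elementary exponential bounds and the size of the moment error terms -/

section MomentErr

/-- **Two elementary exponential bounds (bundled):** `e^{−x} ≤ 1/x` and `e^{−x} ≤ 4/x²` for `x > 0`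
(`eˣ ≥ 1 + x`; `e^{x/2} ≥ x/2`). [folklore] -/
theorem kato_exp_neg_bounds :
    (∀ {x : ℝ}, 0 < x → Real.exp (-x) ≤ 1 / x) ∧ (∀ {x : ℝ}, 0 < x → Real.exp (-x) ≤ 4 / x ^ 2) := by
  refine ⟨fun {x} hx => ?_, fun {x} hx => ?_⟩
  · rw [Real.exp_neg, le_div_iff₀ hx]
    have h := Real.add_one_le_exp x
    have hpos := Real.exp_pos x
    calc (Real.exp x)⁻¹ * x ≤ (Real.exp x)⁻¹ * Real.exp x :=
          mul_le_mul_of_nonneg_left (by linarith) (inv_nonneg.2 hpos.le)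
      _ = 1 := inv_mul_cancel₀ hpos.ne'
  · have h := Real.add_one_le_exp (x / 2)
    have h2 : x / 2 ≤ Real.exp (x / 2) := by linarith
    have h3 : (x / 2) ^ 2 ≤ Real.exp (x / 2) ^ 2 := pow_le_pow_left₀ (by positivity) h2 2
    have h4 : Real.exp (x / 2) ^ 2 = Real.exp x := by rw [← Real.exp_nat_mul]; ring_nf
    rw [h4] at h3
    rw [Real.exp_neg, inv_eq_one_div, div_le_div_iff₀ (Real.exp_pos x) (by positivity)]
    nlinarith

variable {L : ℝ}

/-- **The moment error terms are `a/R + εb(R)`.** For a vorticity slice with `|ω|, |∂_yω| ≤ Ce^{−k|y|}`, `|v| ≤ Ce^{−k|y|}`,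
the cutoff `ψ_R` (`R ≥ 1`, `0 ≤ ψ ≤ 1`, `ψ = 0` for `|y| ≥ 2R`, `|ψ′| ≤ 2C_σ/R`, `ψ′ = 0` for `|y| < R` and `|y| > 2R`)
and `0 ≤ ε`: the six error terms of the moment balance are bounded by an explicit `a/R + ε·b(R)`. [folklore] -/
theorem stub_vorticityUniformBounds_momentErr {L C k ν ε R Cσ : ℝ} (hk : 0 < k) (hC : 0 ≤ C) (hν : 0 ≤ ν) (hε : 0 ≤ ε) (hR : 1 ≤ R)
    (hCσ : 0 ≤ Cσ) {ω vv ωy : ℝ × ℝ → ℝ} (cω : Continuous ω) (cvv : Continuous vv) (cωy : Continuous ωy)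
    (hωb : ∀ q, |ω q| ≤ C * Real.exp (-k * |q.2|)) (hvb : ∀ q, |vv q| ≤ C * Real.exp (-k * |q.2|))
    (hωyb : ∀ q, |ωy q| ≤ C * Real.exp (-k * |q.2|)) {ψ : ℝ → ℝ} (hψ : ContDiff ℝ 1 ψ) (hψ0 : ∀ y, 0 ≤ ψ y)
    (hψ1 : ∀ y, ψ y ≤ 1) (hψR : ∀ y, 2 * R ≤ |y| → ψ y = 0) (hψ'b : ∀ y, |deriv ψ y| ≤ 2 * Cσ / R)
    (hψ'lt : ∀ y, |y| < R → deriv ψ y = 0) (hψ'gt : ∀ y, 2 * R < |y| → deriv ψ y = 0) :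
    ε * (∫ q in Ioc 0 L ×ˢ univ, |vv q| * ψ q.2) +
      (1 + ν) * (ε * ∫ q in Ioc 0 L ×ˢ univ, ψ q.2) +
      ν * (∫ q in Ioc 0 L ×ˢ univ, (|ω q| + ε) * |deriv ψ q.2|) +
      (∫ q in Ioc 0 L ×ˢ univ, (|ω q| + ε) * |vv q| * Real.sqrt (1 + q.2 ^ 2) * |deriv ψ q.2|) +
      (∫ q in Ioc 0 L ×ˢ univ, (|ω q| + ε) * |q.2| * Real.sqrt (1 + q.2 ^ 2) * |deriv ψ q.2|) +
      ν * (∫ q in Ioc 0 L ×ˢ univ, |ωy q| * Real.sqrt (1 + q.2 ^ 2) * |deriv ψ q.2|) ≤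
    (1 / R) * (2 * ν * C * Cσ * (∫ q in Ioc 0 L ×ˢ univ, Real.exp (-k * |q.2|)) +
        8 * Cσ * C ^ 2 / k * (∫ q in Ioc 0 L ×ˢ univ, Real.exp (-k * |q.2|)) +
        384 * Cσ * C / k ^ 2 * (∫ q in Ioc 0 L ×ˢ univ, Real.exp (-(k / 2) * |q.2|)) +
        16 * ν * Cσ * C / k * (∫ q in Ioc 0 L ×ˢ univ, Real.exp (-(k / 2) * |q.2|))) +
      ε * (C * (∫ q in Ioc 0 L ×ˢ univ, Real.exp (-k * |q.2|)) +
        (1 + ν) * Real.exp 3 * (∫ q in Ioc 0 L ×ˢ univ, Real.exp (-(1 / R) * |q.2|)) +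
        2 * ν * Cσ * Real.exp 3 * (∫ q in Ioc 0 L ×ˢ univ, Real.exp (-(1 / R) * |q.2|)) +
        8 * Cσ * C * (∫ q in Ioc 0 L ×ˢ univ, Real.exp (-k * |q.2|)) +
        24 * Cσ * R * Real.exp 3 * (∫ q in Ioc 0 L ×ˢ univ, Real.exp (-(1 / R) * |q.2|))) := by
  obtain ⟨kato_phi_pos, kato_abs_le_phi, kato_phi_le, kato_abs_phi'_le, kato_phi''_le, kato_mul_phi', kato_phi_contDiff,
    kato_phi'_contDiff, kato_phi_ge_one, kato_phi_sq, kato_hasDerivAt_phi, kato_hasDerivAt_phi'⟩ := kato_phi_props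
  obtain ⟨kato_exp_neg_le_inv, kato_exp_neg_le_four_div_sq⟩ := kato_exp_neg_bounds
  have hR0 : 0 < R := one_pos.trans_le hR
  have hS : MeasurableSet (Ioc (0:ℝ) L ×ˢ (univ : Set ℝ)) := measurableSet_Ioc.prod MeasurableSet.univ
  set D : ℝ := 2 * Cσ / R with hDdef
  have hD0 : 0 ≤ D := by positivity
  have hDle : D ≤ 2 * Cσ := div_le_self (by positivity) hR
  set Ik : ℝ := ∫ q in Ioc 0 L ×ˢ univ, Real.exp (-k * |q.2|) with hIk
  set Ik2 : ℝ := ∫ q in Ioc 0 L ×ˢ univ, Real.exp (-(k / 2) * |q.2|) with hIk2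
  set IR : ℝ := ∫ q in Ioc 0 L ×ˢ univ, Real.exp (-(1 / R) * |q.2|) with hIR
  have ik := kato_integrableOn_weight hk L
  have ik2 := kato_integrableOn_weight (half_pos hk) L
  have iR := kato_integrableOn_weight (one_div_pos.2 hR0) L
  have cψ : Continuous ψ := hψ.continuous
  have cψ' : Continuous (deriv ψ) := hψ.continuous_deriv le_rfl
  have hψ'0' : ∀ y, 2 * R + 1 ≤ |y| → deriv ψ y = 0 := fun y hy => hψ'gt y (by linarith)
  have hle1 : ∀ y : ℝ, Real.exp (-k * |y|) ≤ 1 := fun y => Real.exp_le_one_iff.2 (by nlinarith [abs_nonneg y])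
  -- pointwise devices
  -- (w1) the cutoff and its derivative live in `|y| ≤ 2R`, where `1 ≤ e³ e^{−|y|/R}`
  have hw : ∀ y : ℝ, |y| ≤ 2 * R → 1 ≤ Real.exp 3 * Real.exp (-(1 / R) * |y|) := fun y hy => by
    rw [← Real.exp_add]; refine Real.one_le_exp ?_
    have : (1 / R) * |y| ≤ 2 := by rw [one_div, inv_mul_le_iff₀ hR0]; linarith
    linarith
  have hψw : ∀ y, ψ y ≤ Real.exp 3 * Real.exp (-(1 / R) * |y|) := fun y => by
    by_cases hy : 2 * R ≤ |y|
    · rw [hψR y hy]; positivity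
    · exact (hψ1 y).trans (hw y (le_of_lt (not_le.1 hy)))
  have hψ'w : ∀ y, |deriv ψ y| ≤ D * (Real.exp 3 * Real.exp (-(1 / R) * |y|)) := fun y => by
    by_cases hy : 2 * R < |y|
    · rw [hψ'gt y hy, abs_zero]; positivity
    · calc |deriv ψ y| ≤ D * 1 := by rw [mul_one]; exact hψ'b y
        _ ≤ D * (Real.exp 3 * Real.exp (-(1 / R) * |y|)) := mul_le_mul_of_nonneg_left (hw y (not_lt.1 hy)) hD0
  -- (w2) on the support of `ψ′`, `e^{−k|y|} ≤ e^{−kR/2} e^{−(k/2)|y|}` and `e^{−k|y|} ≤ e^{−kR} ≤ 1/(kR)`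
  have hband : ∀ y, deriv ψ y ≠ 0 → R ≤ |y| ∧ |y| ≤ 2 * R := fun y hy =>
    ⟨not_lt.1 fun h => hy (hψ'lt y h), not_lt.1 fun h => hy (hψ'gt y h)⟩
  have hekR : Real.exp (-(k * R)) ≤ 1 / (k * R) := kato_exp_neg_le_inv (by positivity)
  have hekR2 : Real.exp (-(k * R / 2)) ≤ 4 / (k * R / 2) ^ 2 := kato_exp_neg_le_four_div_sq (by positivity)
  have hsplit : ∀ y : ℝ, R ≤ |y| → Real.exp (-k * |y|) ≤ Real.exp (-(k * R / 2)) * Real.exp (-(k / 2) * |y|) := by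
    intro y hy; rw [← Real.exp_add]; exact Real.exp_le_exp.2 (by nlinarith)
  have hsplit' : ∀ y : ℝ, R ≤ |y| → Real.exp (-k * |y|) ≤ Real.exp (-(k * R)) := fun y hy =>
    Real.exp_le_exp.2 (by nlinarith)
  -- `φ|ψ′| ≤ 8Cσ`, `|y|φ|ψ′| ≤ 24CσR e^{…}`-type bounds on the band
  have hφle : ∀ y : ℝ, Real.sqrt (1 + y ^ 2) ≤ 1 + |y| := kato_phi_le
  have hφψ' : ∀ y, Real.sqrt (1 + y ^ 2) * |deriv ψ y| ≤ 8 * Cσ := fun y => by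
    by_cases hy : deriv ψ y = 0
    · rw [hy, abs_zero, mul_zero]; positivity
    · obtain ⟨h1, h2⟩ := hband y hy
      calc Real.sqrt (1 + y ^ 2) * |deriv ψ y| ≤ (1 + 2 * R) * (2 * Cσ / R) :=
            mul_le_mul ((hφle y).trans (by linarith)) (hψ'b y) (abs_nonneg _) (by positivity)
        _ = 2 * Cσ / R + 4 * Cσ := by field_simp; ring
        _ ≤ 2 * Cσ + 4 * Cσ := by linarith [div_le_self (by positivity : 0 ≤ 2 * Cσ) hR]
        _ ≤ 8 * Cσ := by linarith
  -- integrability of all integrands (continuous, with a factor `ψ`, `ψ′` or a decaying weight)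
  have iψ : ∀ F : ℝ × ℝ → ℝ, Continuous F → IntegrableOn (fun q : ℝ × ℝ => F q * ψ q.2) (Ioc 0 L ×ˢ univ) :=
    fun F hF => kato_integrableOn_strip_of_eq_zero (R := 2 * R) (hF.mul (cψ.comp continuous_snd))
      fun x _ y hy => by simp only [hψR y hy, mul_zero]
  have iaψ' : ∀ F : ℝ × ℝ → ℝ, Continuous F → IntegrableOn (fun q : ℝ × ℝ => F q * |deriv ψ q.2|) (Ioc 0 L ×ˢ univ) :=
    fun F hF => kato_integrableOn_strip_of_eq_zero (R := 2 * R + 1) (hF.mul ((cψ'.comp continuous_snd).abs))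
      fun x _ y hy => by simp only [hψ'0' y hy, abs_zero, mul_zero]
  -- T1: `ε ∫ |v| ψ ≤ ε C I_k`
  have T1 : ∫ q in Ioc 0 L ×ˢ univ, |vv q| * ψ q.2 ≤ C * Ik := by
    simp only [hIk]; rw [← integral_const_mul]
    refine integral_mono (iψ _ cvv.abs) (ik.const_mul C) fun q => ?_
    calc |vv q| * ψ q.2 ≤ C * Real.exp (-k * |q.2|) * 1 := mul_le_mul (hvb q) (hψ1 _) (hψ0 _) (by positivity)
      _ = C * Real.exp (-k * |q.2|) := mul_one _
  -- T2: `∫ ψ ≤ e³ I_R`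
  have T2 : ∫ q in Ioc 0 L ×ˢ univ, ψ q.2 ≤ Real.exp 3 * IR := by
    simp only [hIR]; rw [← integral_const_mul]
    have := iψ (fun _ => (1:ℝ)) continuous_const
    simp only [one_mul] at this
    exact integral_mono this (iR.const_mul _) fun q => hψw q.2
  -- T3: `∫ (|ω|+ε)|ψ′| ≤ C D I_k + ε D e³ I_R`
  have T3 : ∫ q in Ioc 0 L ×ˢ univ, (|ω q| + ε) * |deriv ψ q.2| ≤ C * D * Ik + ε * (D * Real.exp 3 * IR) := by
    simp only [hIk, hIR]
    rw [← integral_const_mul, ← integral_const_mul, ← integral_const_mul, ← integral_add (ik.const_mul _)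
      ((iR.const_mul _).const_mul _)]
    refine integral_mono (iaψ' _ (by fun_prop)) ((ik.const_mul _).add ((iR.const_mul _).const_mul _)) fun q => ?_
    simp only
    rw [add_mul]
    refine add_le_add ?_ ?_
    · calc |ω q| * |deriv ψ q.2| ≤ C * Real.exp (-k * |q.2|) * D := mul_le_mul (hωb q) (hψ'b _) (abs_nonneg _) (by positivity)
        _ = C * D * Real.exp (-k * |q.2|) := by ring
    · calc ε * |deriv ψ q.2| ≤ ε * (D * (Real.exp 3 * Real.exp (-(1 / R) * |q.2|))) :=
            mul_le_mul_of_nonneg_left (hψ'w _) hε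
        _ = ε * (D * Real.exp 3 * Real.exp (-(1 / R) * |q.2|)) := by ring
  -- T4: `∫ (|ω|+ε)|v|φ|ψ′| ≤ 8Cσ (C²/(kR) I_k + ε C I_k)`
  have T4 : ∫ q in Ioc 0 L ×ˢ univ, (|ω q| + ε) * |vv q| * Real.sqrt (1 + q.2 ^ 2) * |deriv ψ q.2| ≤
      8 * Cσ * (C ^ 2 * (1 / (k * R)) * Ik) + ε * (8 * Cσ * C * Ik) := by
    simp only [hIk]
    rw [← integral_const_mul, ← integral_const_mul, ← integral_const_mul, ← integral_const_mul,
      ← integral_add ((ik.const_mul _).const_mul _) ((ik.const_mul _).const_mul _)]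
    refine integral_mono (iaψ' _ (by fun_prop)) (((ik.const_mul _).const_mul _).add ((ik.const_mul _).const_mul _))
      fun q => ?_
    simp only
    have hφψ := hφψ' q.2
    have e : (|ω q| + ε) * |vv q| * Real.sqrt (1 + q.2 ^ 2) * |deriv ψ q.2| =
        (|ω q| * |vv q| + ε * |vv q|) * (Real.sqrt (1 + q.2 ^ 2) * |deriv ψ q.2|) := by ring
    rw [e]
    by_cases hy : deriv ψ q.2 = 0
    · rw [hy, abs_zero, mul_zero, mul_zero]; positivity
    · obtain ⟨h1, -⟩ := hband q.2 hy
      have hωv : |ω q| * |vv q| ≤ C ^ 2 * (1 / (k * R)) * Real.exp (-k * |q.2|) := by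
        calc |ω q| * |vv q| ≤ C * Real.exp (-k * |q.2|) * (C * Real.exp (-k * |q.2|)) :=
              mul_le_mul (hωb q) (hvb q) (abs_nonneg _) (by positivity)
          _ = C ^ 2 * Real.exp (-k * |q.2|) * Real.exp (-k * |q.2|) := by ring
          _ ≤ C ^ 2 * (1 / (k * R)) * Real.exp (-k * |q.2|) := by
              refine mul_le_mul_of_nonneg_right (mul_le_mul_of_nonneg_left ((hsplit' q.2 h1).trans hekR) (sq_nonneg _)) (Real.exp_pos _).le
      have hεv : ε * |vv q| ≤ ε * (C * Real.exp (-k * |q.2|)) := mul_le_mul_of_nonneg_left (hvb q) hε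
      calc (|ω q| * |vv q| + ε * |vv q|) * (Real.sqrt (1 + q.2 ^ 2) * |deriv ψ q.2|) ≤
          (C ^ 2 * (1 / (k * R)) * Real.exp (-k * |q.2|) + ε * (C * Real.exp (-k * |q.2|))) * (8 * Cσ) :=
            mul_le_mul (add_le_add hωv hεv) hφψ (by positivity) (by positivity)
        _ = 8 * Cσ * (C ^ 2 * (1 / (k * R)) * Real.exp (-k * |q.2|)) + ε * (8 * Cσ * C * Real.exp (-k * |q.2|)) := by ring
  -- T5: `∫ (|ω|+ε)|y|φ|ψ′| ≤ 384 Cσ C/(k²R) I_{k/2} + ε 24 Cσ R e³ I_R`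
  have T5 : ∫ q in Ioc 0 L ×ˢ univ, (|ω q| + ε) * |q.2| * Real.sqrt (1 + q.2 ^ 2) * |deriv ψ q.2| ≤
      384 * Cσ * C / k ^ 2 * (1 / R) * Ik2 + ε * (24 * Cσ * R * Real.exp 3 * IR) := by
    simp only [hIk2, hIR]
    rw [← integral_const_mul, ← integral_const_mul, ← integral_const_mul, ← integral_add (ik2.const_mul _)
      ((iR.const_mul _).const_mul _)]
    refine integral_mono (iaψ' _ (by fun_prop)) ((ik2.const_mul _).add ((iR.const_mul _).const_mul _)) fun q => ?_
    simp only
    by_cases hy : deriv ψ q.2 = 0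
    · rw [hy, abs_zero, mul_zero]; positivity
    · obtain ⟨h1, h2⟩ := hband q.2 hy
      have hyφψ : |q.2| * Real.sqrt (1 + q.2 ^ 2) * |deriv ψ q.2| ≤ 24 * Cσ * R := by
        calc |q.2| * Real.sqrt (1 + q.2 ^ 2) * |deriv ψ q.2| ≤ 2 * R * (1 + 2 * R) * (2 * Cσ / R) :=
              mul_le_mul (mul_le_mul h2 ((hφle _).trans (by linarith)) (kato_phi_pos _).le (by positivity))
                (hψ'b _) (abs_nonneg _) (by positivity)
          _ = 4 * Cσ * (1 + 2 * R) := by field_simp; ring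
          _ ≤ 24 * Cσ * R := by nlinarith
      have hyφψ' : |q.2| * Real.sqrt (1 + q.2 ^ 2) * |deriv ψ q.2| ≤ 24 * Cσ * R * (Real.exp 3 * Real.exp (-(1 / R) * |q.2|)) :=
        hyφψ.trans (le_mul_of_one_le_right (by positivity) (hw _ h2))
      -- the `ω` part: `C e^{−k|y|} · 24CσR ≤ 384 Cσ C/(k²R) e^{−(k/2)|y|}`
      have hRexp : R * Real.exp (-(k * R / 2)) ≤ 16 / (k ^ 2 * R) := by
        calc R * Real.exp (-(k * R / 2)) ≤ R * (4 / (k * R / 2) ^ 2) := mul_le_mul_of_nonneg_left hekR2 hR0.le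
          _ = 16 / (k ^ 2 * R) := by field_simp; ring
      have hωpart : |ω q| * (|q.2| * Real.sqrt (1 + q.2 ^ 2) * |deriv ψ q.2|) ≤
          384 * Cσ * C / k ^ 2 * (1 / R) * Real.exp (-(k / 2) * |q.2|) := by
        calc |ω q| * (|q.2| * Real.sqrt (1 + q.2 ^ 2) * |deriv ψ q.2|) ≤
            C * Real.exp (-k * |q.2|) * (24 * Cσ * R) := mul_le_mul (hωb q) hyφψ (by positivity) (by positivity)
          _ ≤ C * (Real.exp (-(k * R / 2)) * Real.exp (-(k / 2) * |q.2|)) * (24 * Cσ * R) :=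
              mul_le_mul_of_nonneg_right (mul_le_mul_of_nonneg_left (hsplit q.2 h1) hC) (by positivity)
          _ = 24 * Cσ * C * (R * Real.exp (-(k * R / 2))) * Real.exp (-(k / 2) * |q.2|) := by ring
          _ ≤ 24 * Cσ * C * (16 / (k ^ 2 * R)) * Real.exp (-(k / 2) * |q.2|) := by
              refine mul_le_mul_of_nonneg_right (mul_le_mul_of_nonneg_left hRexp (by positivity)) (Real.exp_pos _).le
          _ = 384 * Cσ * C / k ^ 2 * (1 / R) * Real.exp (-(k / 2) * |q.2|) := by field_simp; ring
      have hεpart : ε * (|q.2| * Real.sqrt (1 + q.2 ^ 2) * |deriv ψ q.2|) ≤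
          ε * (24 * Cσ * R * Real.exp 3 * Real.exp (-(1 / R) * |q.2|)) := by
        refine mul_le_mul_of_nonneg_left (hyφψ'.trans (le_of_eq (by ring))) hε
      calc (|ω q| + ε) * |q.2| * Real.sqrt (1 + q.2 ^ 2) * |deriv ψ q.2| =
          |ω q| * (|q.2| * Real.sqrt (1 + q.2 ^ 2) * |deriv ψ q.2|) + ε * (|q.2| * Real.sqrt (1 + q.2 ^ 2) * |deriv ψ q.2|) := by ring
        _ ≤ _ := add_le_add hωpart hεpart
  -- T6: `∫ |ω_y|φ|ψ′| ≤ 8Cσ C (2/(kR)) I_{k/2}`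
  have T6 : ∫ q in Ioc 0 L ×ˢ univ, |ωy q| * Real.sqrt (1 + q.2 ^ 2) * |deriv ψ q.2| ≤ 16 * Cσ * C / k * (1 / R) * Ik2 := by
    simp only [hIk2]; rw [← integral_const_mul]
    refine integral_mono (iaψ' _ (by fun_prop)) (ik2.const_mul _) fun q => ?_
    simp only
    by_cases hy : deriv ψ q.2 = 0
    · rw [hy, abs_zero, mul_zero]; positivity
    · obtain ⟨h1, -⟩ := hband q.2 hy
      have hekR' : Real.exp (-(k * R / 2)) ≤ 1 / (k * R / 2) := kato_exp_neg_le_inv (by positivity)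
      calc |ωy q| * Real.sqrt (1 + q.2 ^ 2) * |deriv ψ q.2| = |ωy q| * (Real.sqrt (1 + q.2 ^ 2) * |deriv ψ q.2|) := by ring
        _ ≤ C * Real.exp (-k * |q.2|) * (8 * Cσ) := mul_le_mul (hωyb q) (hφψ' _) (by positivity) (by positivity)
        _ ≤ C * (Real.exp (-(k * R / 2)) * Real.exp (-(k / 2) * |q.2|)) * (8 * Cσ) :=
            mul_le_mul_of_nonneg_right (mul_le_mul_of_nonneg_left (hsplit q.2 h1) hC) (by positivity)
        _ ≤ C * ((1 / (k * R / 2)) * Real.exp (-(k / 2) * |q.2|)) * (8 * Cσ) := by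
            refine mul_le_mul_of_nonneg_right (mul_le_mul_of_nonneg_left
              (mul_le_mul_of_nonneg_right hekR' (Real.exp_pos _).le) hC) (by positivity)
        _ = 16 * Cσ * C / k * (1 / R) * Real.exp (-(k / 2) * |q.2|) := by field_simp; ring
  -- assemble
  have hIk0 : 0 ≤ Ik := setIntegral_nonneg hS fun q _ => (Real.exp_pos _).le
  have hIk20 : 0 ≤ Ik2 := setIntegral_nonneg hS fun q _ => (Real.exp_pos _).le
  have hIR0 : 0 ≤ IR := setIntegral_nonneg hS fun q _ => (Real.exp_pos _).le
  have h1 : ε * (∫ q in Ioc 0 L ×ˢ univ, |vv q| * ψ q.2) ≤ ε * (C * Ik) := mul_le_mul_of_nonneg_left T1 hε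
  have h2 : (1 + ν) * (ε * ∫ q in Ioc 0 L ×ˢ univ, ψ q.2) ≤ ε * ((1 + ν) * Real.exp 3 * IR) := by
    have := mul_le_mul_of_nonneg_left (mul_le_mul_of_nonneg_left T2 hε) (by positivity : 0 ≤ 1 + ν)
    linarith
  have h3 : ν * (∫ q in Ioc 0 L ×ˢ univ, (|ω q| + ε) * |deriv ψ q.2|) ≤
      (1 / R) * (2 * ν * C * Cσ * Ik) + ε * (2 * ν * Cσ * Real.exp 3 * IR) := by
    have h := mul_le_mul_of_nonneg_left T3 hν
    have e1 : ν * (C * D * Ik) = (1 / R) * (2 * ν * C * Cσ * Ik) := by simp only [hDdef]; field_simp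
    have e2 : ν * (ε * (D * Real.exp 3 * IR)) ≤ ε * (2 * ν * Cσ * Real.exp 3 * IR) := by
      have h' := mul_le_mul_of_nonneg_left hDle (by positivity : 0 ≤ ν * ε * Real.exp 3 * IR)
      have e3 : ν * (ε * (D * Real.exp 3 * IR)) = ν * ε * Real.exp 3 * IR * D := by ring
      have e4 : ε * (2 * ν * Cσ * Real.exp 3 * IR) = ν * ε * Real.exp 3 * IR * (2 * Cσ) := by ring
      rw [e3, e4]; exact h'
    have e5 : ν * (C * D * Ik + ε * (D * Real.exp 3 * IR)) = ν * (C * D * Ik) + ν * (ε * (D * Real.exp 3 * IR)) := by ring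
    linarith
  have h4 : ∫ q in Ioc 0 L ×ˢ univ, (|ω q| + ε) * |vv q| * Real.sqrt (1 + q.2 ^ 2) * |deriv ψ q.2| ≤
      (1 / R) * (8 * Cσ * C ^ 2 / k * Ik) + ε * (8 * Cσ * C * Ik) := by
    have e : 8 * Cσ * (C ^ 2 * (1 / (k * R)) * Ik) = (1 / R) * (8 * Cσ * C ^ 2 / k * Ik) := by field_simp
    linarith [T4]
  have h5 : ∫ q in Ioc 0 L ×ˢ univ, (|ω q| + ε) * |q.2| * Real.sqrt (1 + q.2 ^ 2) * |deriv ψ q.2| ≤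
      (1 / R) * (384 * Cσ * C / k ^ 2 * Ik2) + ε * (24 * Cσ * R * Real.exp 3 * IR) := by
    have e : 384 * Cσ * C / k ^ 2 * (1 / R) * Ik2 = (1 / R) * (384 * Cσ * C / k ^ 2 * Ik2) := by ring
    linarith [T5]
  have h6 : ν * (∫ q in Ioc 0 L ×ˢ univ, |ωy q| * Real.sqrt (1 + q.2 ^ 2) * |deriv ψ q.2|) ≤
      (1 / R) * (16 * ν * Cσ * C / k * Ik2) := by
    have h := mul_le_mul_of_nonneg_left T6 hν
    have e : ν * (16 * Cσ * C / k * (1 / R) * Ik2) = (1 / R) * (16 * ν * Cσ * C / k * Ik2) := by ring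
    linarith
  have e7 : (1 / R) * (2 * ν * C * Cσ * Ik + 8 * Cσ * C ^ 2 / k * Ik + 384 * Cσ * C / k ^ 2 * Ik2 + 16 * ν * Cσ * C / k * Ik2) =
      (1 / R) * (2 * ν * C * Cσ * Ik) + (1 / R) * (8 * Cσ * C ^ 2 / k * Ik) + (1 / R) * (384 * Cσ * C / k ^ 2 * Ik2) +
        (1 / R) * (16 * ν * Cσ * C / k * Ik2) := by ring
  have e8 : ε * (C * Ik + (1 + ν) * Real.exp 3 * IR + 2 * ν * Cσ * Real.exp 3 * IR + 8 * Cσ * C * Ik +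
      24 * Cσ * R * Real.exp 3 * IR) = ε * (C * Ik) + ε * ((1 + ν) * Real.exp 3 * IR) +
      ε * (2 * ν * Cσ * Real.exp 3 * IR) + ε * (8 * Cσ * C * Ik) + ε * (24 * Cσ * R * Real.exp 3 * IR) := by ring
  rw [e7, e8]
  linarith [h1, h2, h3, h4, h5, h6]

end MomentErr

end Summit.AnomalousDissipation.AnomalousDissipation.Theorems.StrainedLayerLaw.StrainWorkSumRule

end
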